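/-
Copyright (c) 2026 the pub-hodgecm-mathlib formalisation cell (harness21).  Prover seat hodgecm-mathlib-LH5-p04 (g11), 2026-09-03.  E1 row 56-B3(55-PF) «PLACE-FREE SIBLINGS OF
THE 55-A FILES», file (T-I): Layer I (any isometric involution, hypothesis-style) of the twin of ★ A-II `UnitaryLatticeTreeHorosphereTransversal` (keeper F0P3a-p03 (g30)
04:09:00Z ∕ «=» 04:13:25Z; census `CENSUS-SIGSHEET-B355PF.v1` 4e3d4b85fe811f96).  Layer II (tame dischargers `_of_neg`) = `UnitaryLatticeTreeHorosphereTransversalRamified`.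
-/
import Literature.NumberTheory.Automorphic.UnitaryLatticeTreeHorosphereTransversal             -- ★ A-II p853487 (LH5-p05 (g12)): the datum-free `mem_unitaryInt_of_glDiagonal_eq_of_v_eq_one`; brings ★ `borelU ∕ torusU ∕ unipotentU`, `isComplement'_torusU_unipotentU`, `latticeGraphIso_*_apply`
import Literature.NumberTheory.Automorphic.UnitaryLatticeTreeHorocycleStepsOfInvolution          -- (S) (this seat): (H1) `…_of_mem_unipotentU_of_v`; brings ★ R1 (T) `…_eq_add_of_involution`, (T′) `…_of_unit_diagonal_of_v`
import Literature.NumberTheory.Automorphic.UnitaryLatticeTreeGeodesicApartmentOfInvolution       -- ★ B1 p853459 (LH5-p04 (g10)): `latticeGraph_adj_apartmentEnum_succ_of_involution`, `dist_apartmentEnum_of_involution`, `dist_latticeGraphIso_apartmentEnum_of_involution` (tree hypothesis `hT`)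
import HarnessLib

/-!
# Horospheres of the `U(3)` tree FOR ANY ISOMETRIC INVOLUTION, hypothesis-style: `N`-orbits meet the standard apartment exactly once; Borel stabilisers and `B`-orbits
# (Bruhat–Tits 1972 §10, (7.4.18); Serre, *Trees* II.1.1, I.2.2, I.6.4)

Topic `NumberTheory/Automorphic`; namespace `Literature.NumberTheory.Automorphic.UnitaryLatticeTree`.  THEOREMS ONLY (no definition, no instance, no notation, no named
fact, no `sorry`).  Cell `pub/hodgecm-mathlib` (D-0151), crux H413 = `stmt-HodgeConjecture-24833`, lane `--supports`; E1 BRICK LEDGER row 56-B3(55-PF) (keeper F0P3a-p03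
(g30); LEAD T15-42 (iii)): Layer I of the PLACE-FREE sibling of ★ A-II `UnitaryLatticeTreeHorosphereTransversal` ((H5)–(H8)).  ★ A-II binds the UNRAMIFIED datum
`hd : UnramifiedLocalConjDatum σ ϖ` but reads of it only `|ϖ| = exp(−1)` and `|σ·| = |·|`; what is genuinely unramified sits in its CALLEES — the star dichotomy (H4), the
tree-ness of the lattice graph (with 39γ's apartment metric), the torus translation (T).  Here `σ` is ANY isometric involution (`hσ : σ² = 1`, `hvσ : |σ·| = |·|`), `ϖ` ANY
uniformiser (`hϖ : |ϖ| = exp(−1)`, NO hypothesis on `σϖ`), the enumerated apartment is HYPOTHESIS-STYLE `(A, hA0, hA1)` as in ★ 39γ ∕ ★ B1, and the two unramified-rooted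
inputs are HYPOTHESES named for the token pass: **`hT : (latticeGraph σ ϖ J₀).IsTree`** and **`hH4 : ∀ j y, Adj (A j) y → y = A (j − 1) ∨ ∃ n ∈ N, n · A j = A j ∧ n · A (j+1)
= y`** (★ (H4)'s conclusion ∀-closed; supplied for any involution by `eq_apartmentEnum_sub_one_or_exists_mem_unipotentU_of_adj_of_involution`, at tame places by
`…_of_adj_of_neg`); (T) ∕ (T′) are R1's any-involution heads BY IMPORT (torus element `diag(ϖ^c, 1, (σϖ)^{−c})`).  Every conclusion is ★ A-II's VERBATIM (the edge
certificates print ★ B1's `latticeGraph_adj_apartmentEnum_succ_of_involution` — proof-irrelevant); every proof is ★ A-II's with the callees swapped; head names = ★ name +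
`_of_involution`.  (H8₀) and (H8′) turn out PLACE-FREE (no `hT`, no `hH4`).  The tame dischargers (`hT`, `hH4` ↦ ★ `isTree_latticeGraph_three_of_neg`, (S) `…_of_neg`) are
the one-liners of `UnitaryLatticeTreeHorosphereTransversalRamified` (400-line rule).  HONEST LABEL: count-neutral generic lattice-tree layer (TAME road GO-LOW, WILD = PRINT;
E1 = PRINT); HC_CM is proved only modulo the 7 printed citations (2 remaining named inputs hLiu418 = `stmt-HodgeConjecture-24832`, h413 = `stmt-HodgeConjecture-24833`)
until rung 0 closes; nothing printed is asserted here — elementary lattice algebra over a valued field and tree combinatorics.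

WHAT IS FORMALISED (binders `(hσ hvσ hϖ) (A hA0 hA1) (hT) (hH4)`, each head printing only those it uses): §1 (H5) `exists_mem_unipotentU_latticeGraphIso_apartmentEnum_eq_of_involution
(A) (hT) (hH4)`; §2 (H6) `eq_of_mem_unipotentU_of_latticeGraphIso_apartmentEnum_eq_of_involution`, `…_eq₂_of_involution`, `existsUnique_apartmentEnum_index_of_involution`; §3 (H7)
`…_eq_of_adj_of_involution`, `…sym2Map…_of_adj_of_involution`, `…mapEdgeSet…_of_involution` + the three uniqueness forms; §4 (H8₀) `…_eq_add_of_mem_torusU_of_involution` (place-free),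
(H8) `exists_torusU_mul_unipotentU_of_mem_borelU_…_of_involution (… hT)`, (H8′) `…_of_mem_borelU_of_involution` (place-free).

## References
* [BruhatTits1972] F. Bruhat, J. Tits, *Groupes réductifs sur un corps local I*, Publ. Math. IHÉS 41 (1972), §10 (lattice models of the classical groups), (7.4.18).
* [Serre1980Trees] J.-P. Serre, *Trees* (1980), Ch. II §1.1 (the tree of `SL₂` over a local field: lattice classes, the straight path of diagonal lattices, stabilisers),
  Ch. I §2.2 Prop. 8 (geodesics in a tree), Ch. I §6.4 (translations along an axis).
-/

set_option autoImplicit false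

open scoped Valued WithZero Matrix MatrixGroups

namespace Literature.NumberTheory.Automorphic.UnitaryLatticeTree

open _root_.SimpleGraph Literature.NumberTheory.Automorphic Literature.NumberTheory.Automorphic.HermitianLattice
open Literature.NumberTheory.Automorphic.UnitaryGroup
open Literature.Combinatorics.SimpleGraph

variable {K : Type*} [Field K] [Valued K ℤᵐ⁰] {σ : K →+* K} {ϖ : K}

/-! ## §1 (H5) EXISTENCE, hypothesis-style: every vertex lies on an `N`-translate of the standard apartment -/

/-- **(H5) HYPOTHESIS-STYLE — EVERY VERTEX IS `n · A j` FOR SOME `n ∈ N`, `j ∈ ℤ`.**  Twin of ★ `exists_mem_unipotentU_latticeGraphIso_apartmentEnum_eq` with its two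
unramified-rooted inputs taken as hypotheses: the star dichotomy `hH4` (★ (H4)'s conclusion ∀-closed; any-involution ∕ tame forms in `UnitaryLatticeTreeHorocycleStepsOfInvolution`)
and the tree-ness `hT` of the lattice graph (★ at unramified places, ★ `isTree_latticeGraph_three_of_neg` at tame ones); no `σ`-letter is read.  Conclusion VERBATIM; proof = ★'s
(induction on a walk from an apartment vertex). [cite: BruhatTits1972, §10] [cite: Serre1980Trees, II.1.1] -/
theorem exists_mem_unipotentU_latticeGraphIso_apartmentEnum_eq_of_involution
    (A : ℤ → {M : Submodule 𝒪[K] (Fin 3 → K) // IsVertex σ ϖ ((StdForm.antidiagonal 3).over K) M})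
    (hT : (latticeGraph σ ϖ ((StdForm.antidiagonal 3).over K)).IsTree)
    (hH4 : ∀ (j : ℤ) (y : {M : Submodule 𝒪[K] (Fin 3 → K) // IsVertex σ ϖ ((StdForm.antidiagonal 3).over K) M}),
      (latticeGraph σ ϖ ((StdForm.antidiagonal 3).over K)).Adj (A j) y → y = A (j - 1) ∨
      ∃ n : unitaryGroupOfForm σ ((StdForm.antidiagonal 3).over K), n ∈ unipotentU σ ((StdForm.antidiagonal 3).over K) ∧
        latticeGraphIso σ ϖ ((StdForm.antidiagonal 3).over K) n (A j) = A j ∧ latticeGraphIso σ ϖ ((StdForm.antidiagonal 3).over K) n (A (j + 1)) = y)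
    (x : {M : Submodule 𝒪[K] (Fin 3 → K) // IsVertex σ ϖ ((StdForm.antidiagonal 3).over K) M}) :
    ∃ n : unitaryGroupOfForm σ ((StdForm.antidiagonal 3).over K), n ∈ unipotentU σ ((StdForm.antidiagonal 3).over K) ∧
      ∃ j : ℤ, latticeGraphIso σ ϖ ((StdForm.antidiagonal 3).over K) n (A j) = x := by
  have key : ∀ (ℓ : ℕ) (j : ℤ) (x : {M : Submodule 𝒪[K] (Fin 3 → K) // IsVertex σ ϖ ((StdForm.antidiagonal 3).over K) M})
      (p : (latticeGraph σ ϖ ((StdForm.antidiagonal 3).over K)).Walk (A j) x), p.length = ℓ →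
      ∃ n : unitaryGroupOfForm σ ((StdForm.antidiagonal 3).over K), n ∈ unipotentU σ ((StdForm.antidiagonal 3).over K) ∧
        ∃ i : ℤ, latticeGraphIso σ ϖ ((StdForm.antidiagonal 3).over K) n (A i) = x := by
    intro ℓ
    induction ℓ with
    | zero =>
      intro j x p hp
      exact ⟨1, one_mem _, j, by rw [latticeGraphIso_one_apply]; exact Walk.eq_of_length_eq_zero hp⟩
    | succ ℓ ih =>
      intro j x p hp
      cases p with
      | nil => exact absurd hp (by simp)
      | cons hadj q =>
        rename_i y
        rw [Walk.length_cons] at hp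
        have hq : q.length = ℓ := by omega
        rcases hH4 j _ hadj with rfl | ⟨n, hn, -, hny⟩
        · exact ih (j - 1) x q hq
        · have hy' : latticeGraphIso σ ϖ ((StdForm.antidiagonal 3).over K) n⁻¹ y = A (j + 1) := by
            rw [← hny, latticeGraphIso_inv_mul_apply]
          obtain ⟨n', hn', i, hi⟩ := ih (j + 1) (latticeGraphIso σ ϖ ((StdForm.antidiagonal 3).over K) n⁻¹ x)
            ((q.map (latticeGraphIso σ ϖ ((StdForm.antidiagonal 3).over K) n⁻¹).toHom).copy hy' rfl)
            (by rw [Walk.length_copy, Walk.length_map]; exact hq)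
          refine ⟨n * n', mul_mem hn hn', i, ?_⟩
          rw [latticeGraphIso_mul_apply, hi, latticeGraphIso_mul_inv_apply]
  obtain ⟨p⟩ := hT.connected.preconnected (A 0) x
  exact key _ 0 x p rfl

/-! ## §2 (H6) UNIQUENESS for any isometric involution: the apartment index of a horosphere is well defined -/

/-- **(H6) FOR ANY ISOMETRIC INVOLUTION — `n · A i = A j` WITH `n ∈ N` FORCES `i = j`.**  Twin of ★ `eq_of_mem_unipotentU_of_latticeGraphIso_apartmentEnum_eq`: (H1) is place-free
(`…_of_mem_unipotentU_of_v hϖ`), the apartment metric is ★ B1's `dist_apartmentEnum_of_involution` ∕ `dist_latticeGraphIso_apartmentEnum_of_involution` over the tree hypothesis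
`hT`.  Conclusion VERBATIM. [cite: BruhatTits1972, §10] [cite: Serre1980Trees, II.1.1; I.2.2 Prop. 8] -/
theorem eq_of_mem_unipotentU_of_latticeGraphIso_apartmentEnum_eq_of_involution (hσ : ∀ x, σ (σ x) = x) (hvσ : ∀ a, Valued.v (σ a) = Valued.v a) (hϖ : Valued.v ϖ = WithZero.exp (-1 : ℤ))
    (A : ℤ → {M : Submodule 𝒪[K] (Fin 3 → K) // IsVertex σ ϖ ((StdForm.antidiagonal 3).over K) M})
    (hA0 : ∀ a : ℤ, (A (2 * a)).1 = latt (Matrix.diagonal ![ϖ ^ a, (1 : K), ϖ ^ (-a)]))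
    (hA1 : ∀ a : ℤ, (A (2 * a + 1)).1 = latt (Matrix.diagonal ![ϖ ^ (a + 1), (1 : K), ϖ ^ (-a)]))
    (hT : (latticeGraph σ ϖ ((StdForm.antidiagonal 3).over K)).IsTree)
    {n : unitaryGroupOfForm σ ((StdForm.antidiagonal 3).over K)}
    (hn : n ∈ unipotentU σ ((StdForm.antidiagonal 3).over K)) {i j : ℤ} (h : latticeGraphIso σ ϖ ((StdForm.antidiagonal 3).over K) n (A i) = A j) :
    i = j := by
  obtain ⟨j₀, hj₀⟩ := exists_forall_le_latticeGraphIso_apartmentEnum_eq_self_of_mem_unipotentU_of_v hϖ A hA0 hA1 hn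
  have hki : min j₀ (min i j) ≤ i := (min_le_right _ _).trans (min_le_left _ _)
  have hkj : min j₀ (min i j) ≤ j := (min_le_right _ _).trans (min_le_right _ _)
  have hfix := hj₀ (min j₀ (min i j)) (min_le_left _ _)
  have h1 := dist_latticeGraphIso_apartmentEnum_of_involution hσ hvσ hϖ A hA0 hA1 hT n (min j₀ (min i j)) i
  rw [hfix, h, dist_apartmentEnum_of_involution hσ hvσ hϖ A hA0 hA1 hT] at h1
  omega

/-- **(H6₂) two-element form, any isometric involution**: `n · A i = n′ · A j` with `n, n′ ∈ N` forces `i = j`.  Conclusion VERBATIM = ★ `…_eq₂`'s. [cite: BruhatTits1972, §10] [cite: Serre1980Trees, II.1.1] -/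
theorem eq_of_mem_unipotentU_of_latticeGraphIso_apartmentEnum_eq₂_of_involution (hσ : ∀ x, σ (σ x) = x) (hvσ : ∀ a, Valued.v (σ a) = Valued.v a) (hϖ : Valued.v ϖ = WithZero.exp (-1 : ℤ))
    (A : ℤ → {M : Submodule 𝒪[K] (Fin 3 → K) // IsVertex σ ϖ ((StdForm.antidiagonal 3).over K) M})
    (hA0 : ∀ a : ℤ, (A (2 * a)).1 = latt (Matrix.diagonal ![ϖ ^ a, (1 : K), ϖ ^ (-a)]))
    (hA1 : ∀ a : ℤ, (A (2 * a + 1)).1 = latt (Matrix.diagonal ![ϖ ^ (a + 1), (1 : K), ϖ ^ (-a)]))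
    (hT : (latticeGraph σ ϖ ((StdForm.antidiagonal 3).over K)).IsTree)
    {n n' : unitaryGroupOfForm σ ((StdForm.antidiagonal 3).over K)}
    (hn : n ∈ unipotentU σ ((StdForm.antidiagonal 3).over K)) (hn' : n' ∈ unipotentU σ ((StdForm.antidiagonal 3).over K)) {i j : ℤ}
    (h : latticeGraphIso σ ϖ ((StdForm.antidiagonal 3).over K) n (A i) = latticeGraphIso σ ϖ ((StdForm.antidiagonal 3).over K) n' (A j)) : i = j :=
  eq_of_mem_unipotentU_of_latticeGraphIso_apartmentEnum_eq_of_involution hσ hvσ hϖ A hA0 hA1 hT (n := n'⁻¹ * n) (mul_mem (inv_mem hn') hn)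
    (by rw [latticeGraphIso_mul_apply, h, latticeGraphIso_inv_mul_apply])

/-- **(H6!) THE APARTMENT INDEX OF A VERTEX, hypothesis-style**: a unique `j : ℤ` with `x ∈ N · A j` (existence (H5) over `hT`, `hH4`; uniqueness (H6₂)).  Conclusion VERBATIM =
★ `existsUnique_apartmentEnum_index`'s. [cite: BruhatTits1972, §10] [cite: Serre1980Trees, II.1.1] -/
theorem existsUnique_apartmentEnum_index_of_involution (hσ : ∀ x, σ (σ x) = x) (hvσ : ∀ a, Valued.v (σ a) = Valued.v a) (hϖ : Valued.v ϖ = WithZero.exp (-1 : ℤ))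
    (A : ℤ → {M : Submodule 𝒪[K] (Fin 3 → K) // IsVertex σ ϖ ((StdForm.antidiagonal 3).over K) M})
    (hA0 : ∀ a : ℤ, (A (2 * a)).1 = latt (Matrix.diagonal ![ϖ ^ a, (1 : K), ϖ ^ (-a)]))
    (hA1 : ∀ a : ℤ, (A (2 * a + 1)).1 = latt (Matrix.diagonal ![ϖ ^ (a + 1), (1 : K), ϖ ^ (-a)]))
    (hT : (latticeGraph σ ϖ ((StdForm.antidiagonal 3).over K)).IsTree)
    (hH4 : ∀ (j : ℤ) (y : {M : Submodule 𝒪[K] (Fin 3 → K) // IsVertex σ ϖ ((StdForm.antidiagonal 3).over K) M}),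
      (latticeGraph σ ϖ ((StdForm.antidiagonal 3).over K)).Adj (A j) y → y = A (j - 1) ∨
      ∃ n : unitaryGroupOfForm σ ((StdForm.antidiagonal 3).over K), n ∈ unipotentU σ ((StdForm.antidiagonal 3).over K) ∧
        latticeGraphIso σ ϖ ((StdForm.antidiagonal 3).over K) n (A j) = A j ∧ latticeGraphIso σ ϖ ((StdForm.antidiagonal 3).over K) n (A (j + 1)) = y)
    (x : {M : Submodule 𝒪[K] (Fin 3 → K) // IsVertex σ ϖ ((StdForm.antidiagonal 3).over K) M}) :
    ∃! j : ℤ, ∃ n : unitaryGroupOfForm σ ((StdForm.antidiagonal 3).over K), n ∈ unipotentU σ ((StdForm.antidiagonal 3).over K) ∧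
      latticeGraphIso σ ϖ ((StdForm.antidiagonal 3).over K) n (A j) = x := by
  obtain ⟨n, hn, j, hj⟩ := exists_mem_unipotentU_latticeGraphIso_apartmentEnum_eq_of_involution A hT hH4 x
  refine ⟨j, ⟨n, hn, hj⟩, ?_⟩
  rintro j' ⟨n', hn', hj'⟩
  exact eq_of_mem_unipotentU_of_latticeGraphIso_apartmentEnum_eq₂_of_involution hσ hvσ hϖ A hA0 hA1 hT hn' hn (hj'.trans hj.symm)

/-! ## §3 (H7) EDGES: every edge is an `N`-translate of a unique apartment edge -/

/-- **(H7) HYPOTHESIS-STYLE — EVERY EDGE IS `n · {A j, A (j+1)}`**, oriented form ((H5) at `x`, then the star dichotomy `hH4` at the neighbour `n⁻¹ · y` of `A j`); no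
`σ`-letter is read.  Conclusion VERBATIM = ★ `exists_mem_unipotentU_latticeGraphIso_apartmentEnum_eq_of_adj`'s. [cite: BruhatTits1972, §10] [cite: Serre1980Trees, II.1.1] -/
theorem exists_mem_unipotentU_latticeGraphIso_apartmentEnum_eq_of_adj_of_involution
    (A : ℤ → {M : Submodule 𝒪[K] (Fin 3 → K) // IsVertex σ ϖ ((StdForm.antidiagonal 3).over K) M})
    (hT : (latticeGraph σ ϖ ((StdForm.antidiagonal 3).over K)).IsTree)
    (hH4 : ∀ (j : ℤ) (y : {M : Submodule 𝒪[K] (Fin 3 → K) // IsVertex σ ϖ ((StdForm.antidiagonal 3).over K) M}),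
      (latticeGraph σ ϖ ((StdForm.antidiagonal 3).over K)).Adj (A j) y → y = A (j - 1) ∨
      ∃ n : unitaryGroupOfForm σ ((StdForm.antidiagonal 3).over K), n ∈ unipotentU σ ((StdForm.antidiagonal 3).over K) ∧
        latticeGraphIso σ ϖ ((StdForm.antidiagonal 3).over K) n (A j) = A j ∧ latticeGraphIso σ ϖ ((StdForm.antidiagonal 3).over K) n (A (j + 1)) = y)
    {x y : {M : Submodule 𝒪[K] (Fin 3 → K) // IsVertex σ ϖ ((StdForm.antidiagonal 3).over K) M}}
    (hxy : (latticeGraph σ ϖ ((StdForm.antidiagonal 3).over K)).Adj x y) :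
    ∃ n : unitaryGroupOfForm σ ((StdForm.antidiagonal 3).over K), n ∈ unipotentU σ ((StdForm.antidiagonal 3).over K) ∧ ∃ j : ℤ,
      (latticeGraphIso σ ϖ ((StdForm.antidiagonal 3).over K) n (A j) = x ∧ latticeGraphIso σ ϖ ((StdForm.antidiagonal 3).over K) n (A (j + 1)) = y) ∨
      (latticeGraphIso σ ϖ ((StdForm.antidiagonal 3).over K) n (A (j + 1)) = x ∧ latticeGraphIso σ ϖ ((StdForm.antidiagonal 3).over K) n (A j) = y) := by
  obtain ⟨n, hn, j, hj⟩ := exists_mem_unipotentU_latticeGraphIso_apartmentEnum_eq_of_involution A hT hH4 x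
  have hadj : (latticeGraph σ ϖ ((StdForm.antidiagonal 3).over K)).Adj (A j) (latticeGraphIso σ ϖ ((StdForm.antidiagonal 3).over K) n⁻¹ y) := by
    have := ((latticeGraphIso σ ϖ ((StdForm.antidiagonal 3).over K) n⁻¹).map_adj_iff).2 hxy
    rwa [← hj, latticeGraphIso_inv_mul_apply] at this
  rcases hH4 j _ hadj with hy | ⟨n', hn', hn'j, hn'y⟩
  · refine ⟨n, hn, j - 1, Or.inr ⟨?_, ?_⟩⟩
    · rw [sub_add_cancel, hj]
    · rw [← hy, latticeGraphIso_mul_inv_apply]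
  · refine ⟨n * n', mul_mem hn hn', j, Or.inl ⟨?_, ?_⟩⟩
    · rw [latticeGraphIso_mul_apply, hn'j, hj]
    · rw [latticeGraphIso_mul_apply, hn'y, latticeGraphIso_mul_inv_apply]

/-- **(H7s) `Sym2` form, hypothesis-style**: `s(x, y) = n · s(A j, A (j+1))` for some `n ∈ N`, `j ∈ ℤ`.  Conclusion VERBATIM = ★ `…sym2Map…_of_adj`'s. [cite: BruhatTits1972, §10] [cite: Serre1980Trees, II.1.1] -/
theorem exists_mem_unipotentU_sym2Map_apartmentEnum_eq_of_adj_of_involution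
    (A : ℤ → {M : Submodule 𝒪[K] (Fin 3 → K) // IsVertex σ ϖ ((StdForm.antidiagonal 3).over K) M})
    (hT : (latticeGraph σ ϖ ((StdForm.antidiagonal 3).over K)).IsTree)
    (hH4 : ∀ (j : ℤ) (y : {M : Submodule 𝒪[K] (Fin 3 → K) // IsVertex σ ϖ ((StdForm.antidiagonal 3).over K) M}),
      (latticeGraph σ ϖ ((StdForm.antidiagonal 3).over K)).Adj (A j) y → y = A (j - 1) ∨
      ∃ n : unitaryGroupOfForm σ ((StdForm.antidiagonal 3).over K), n ∈ unipotentU σ ((StdForm.antidiagonal 3).over K) ∧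
        latticeGraphIso σ ϖ ((StdForm.antidiagonal 3).over K) n (A j) = A j ∧ latticeGraphIso σ ϖ ((StdForm.antidiagonal 3).over K) n (A (j + 1)) = y)
    {x y : {M : Submodule 𝒪[K] (Fin 3 → K) // IsVertex σ ϖ ((StdForm.antidiagonal 3).over K) M}}
    (hxy : (latticeGraph σ ϖ ((StdForm.antidiagonal 3).over K)).Adj x y) :
    ∃ n : unitaryGroupOfForm σ ((StdForm.antidiagonal 3).over K), n ∈ unipotentU σ ((StdForm.antidiagonal 3).over K) ∧ ∃ j : ℤ,
      Sym2.map (latticeGraphIso σ ϖ ((StdForm.antidiagonal 3).over K) n) s(A j, A (j + 1)) = s(x, y) := by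
  obtain ⟨n, hn, j, h⟩ := exists_mem_unipotentU_latticeGraphIso_apartmentEnum_eq_of_adj_of_involution A hT hH4 hxy
  refine ⟨n, hn, j, ?_⟩
  rw [Sym2.map_mk, Sym2.eq_iff]
  rcases h with ⟨h1, h2⟩ | ⟨h1, h2⟩
  · exact Or.inl ⟨h1, h2⟩
  · exact Or.inr ⟨h2, h1⟩

/-- **(H7e) `edgeSet` form, any isometric involution** (the consumers' currency `act₁ g := (latticeGraphIso … g).mapEdgeSet`): every edge is the image of an apartment edge
`⟨s(A j, A (j+1)), _⟩` under some `n ∈ N`; the membership certificate printed is ★ B1's `latticeGraph_adj_apartmentEnum_succ_of_involution` (proof-irrelevant: the subtype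
value is ★ (H7e)'s).  Conclusion VERBATIM otherwise. [cite: BruhatTits1972, §10] [cite: Serre1980Trees, II.1.1] -/
theorem exists_mem_unipotentU_mapEdgeSet_apartmentEnum_eq_of_involution (hσ : ∀ x, σ (σ x) = x) (hvσ : ∀ a, Valued.v (σ a) = Valued.v a) (hϖ : Valued.v ϖ = WithZero.exp (-1 : ℤ))
    (A : ℤ → {M : Submodule 𝒪[K] (Fin 3 → K) // IsVertex σ ϖ ((StdForm.antidiagonal 3).over K) M})
    (hA0 : ∀ a : ℤ, (A (2 * a)).1 = latt (Matrix.diagonal ![ϖ ^ a, (1 : K), ϖ ^ (-a)]))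
    (hA1 : ∀ a : ℤ, (A (2 * a + 1)).1 = latt (Matrix.diagonal ![ϖ ^ (a + 1), (1 : K), ϖ ^ (-a)]))
    (hT : (latticeGraph σ ϖ ((StdForm.antidiagonal 3).over K)).IsTree)
    (hH4 : ∀ (j : ℤ) (y : {M : Submodule 𝒪[K] (Fin 3 → K) // IsVertex σ ϖ ((StdForm.antidiagonal 3).over K) M}),
      (latticeGraph σ ϖ ((StdForm.antidiagonal 3).over K)).Adj (A j) y → y = A (j - 1) ∨
      ∃ n : unitaryGroupOfForm σ ((StdForm.antidiagonal 3).over K), n ∈ unipotentU σ ((StdForm.antidiagonal 3).over K) ∧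
        latticeGraphIso σ ϖ ((StdForm.antidiagonal 3).over K) n (A j) = A j ∧ latticeGraphIso σ ϖ ((StdForm.antidiagonal 3).over K) n (A (j + 1)) = y)
    (e : (latticeGraph σ ϖ ((StdForm.antidiagonal 3).over K)).edgeSet) :
    ∃ n : unitaryGroupOfForm σ ((StdForm.antidiagonal 3).over K), n ∈ unipotentU σ ((StdForm.antidiagonal 3).over K) ∧ ∃ j : ℤ,
      (latticeGraphIso σ ϖ ((StdForm.antidiagonal 3).over K) n).mapEdgeSet
          ⟨s(A j, A (j + 1)), (mem_edgeSet _).2 (latticeGraph_adj_apartmentEnum_succ_of_involution hσ hvσ hϖ A hA0 hA1 j)⟩ = e := by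
  obtain ⟨e, he⟩ := e
  induction e using Sym2.ind with
  | h x y =>
    obtain ⟨n, hn, j, h⟩ := exists_mem_unipotentU_sym2Map_apartmentEnum_eq_of_adj_of_involution A hT hH4 ((mem_edgeSet _).1 he)
    exact ⟨n, hn, j, Subtype.ext h⟩

/-- **(H7!) THE APARTMENT INDEX OF AN EDGE IS WELL DEFINED, any isometric involution**: `n · s(A i, A (i+1)) = s(A j, A (j+1))` with `n ∈ N` forces `i = j` ((H6) on both
ends).  Conclusion VERBATIM = ★'s. [cite: BruhatTits1972, §10] [cite: Serre1980Trees, II.1.1] -/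
theorem eq_of_mem_unipotentU_of_sym2Map_apartmentEnum_eq_of_involution (hσ : ∀ x, σ (σ x) = x) (hvσ : ∀ a, Valued.v (σ a) = Valued.v a) (hϖ : Valued.v ϖ = WithZero.exp (-1 : ℤ))
    (A : ℤ → {M : Submodule 𝒪[K] (Fin 3 → K) // IsVertex σ ϖ ((StdForm.antidiagonal 3).over K) M})
    (hA0 : ∀ a : ℤ, (A (2 * a)).1 = latt (Matrix.diagonal ![ϖ ^ a, (1 : K), ϖ ^ (-a)]))
    (hA1 : ∀ a : ℤ, (A (2 * a + 1)).1 = latt (Matrix.diagonal ![ϖ ^ (a + 1), (1 : K), ϖ ^ (-a)]))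
    (hT : (latticeGraph σ ϖ ((StdForm.antidiagonal 3).over K)).IsTree)
    {n : unitaryGroupOfForm σ ((StdForm.antidiagonal 3).over K)}
    (hn : n ∈ unipotentU σ ((StdForm.antidiagonal 3).over K)) {i j : ℤ}
    (h : Sym2.map (latticeGraphIso σ ϖ ((StdForm.antidiagonal 3).over K) n) s(A i, A (i + 1)) = s(A j, A (j + 1))) : i = j := by
  rw [Sym2.map_mk, Sym2.eq_iff] at h
  rcases h with ⟨h1, -⟩ | ⟨h1, h2⟩
  · exact eq_of_mem_unipotentU_of_latticeGraphIso_apartmentEnum_eq_of_involution hσ hvσ hϖ A hA0 hA1 hT hn h1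
  · have e1 := eq_of_mem_unipotentU_of_latticeGraphIso_apartmentEnum_eq_of_involution hσ hvσ hϖ A hA0 hA1 hT hn h1
    have e2 := eq_of_mem_unipotentU_of_latticeGraphIso_apartmentEnum_eq_of_involution hσ hvσ hϖ A hA0 hA1 hT hn h2
    omega

/-- **(H7!₂) two-element form, any isometric involution**: `n · s(A i, A (i+1)) = n′ · s(A j, A (j+1))` with `n, n′ ∈ N` forces `i = j`.  Conclusion VERBATIM = ★'s. [cite: BruhatTits1972, §10] [cite: Serre1980Trees, II.1.1] -/
theorem eq_of_mem_unipotentU_of_sym2Map_apartmentEnum_eq₂_of_involution (hσ : ∀ x, σ (σ x) = x) (hvσ : ∀ a, Valued.v (σ a) = Valued.v a) (hϖ : Valued.v ϖ = WithZero.exp (-1 : ℤ))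
    (A : ℤ → {M : Submodule 𝒪[K] (Fin 3 → K) // IsVertex σ ϖ ((StdForm.antidiagonal 3).over K) M})
    (hA0 : ∀ a : ℤ, (A (2 * a)).1 = latt (Matrix.diagonal ![ϖ ^ a, (1 : K), ϖ ^ (-a)]))
    (hA1 : ∀ a : ℤ, (A (2 * a + 1)).1 = latt (Matrix.diagonal ![ϖ ^ (a + 1), (1 : K), ϖ ^ (-a)]))
    (hT : (latticeGraph σ ϖ ((StdForm.antidiagonal 3).over K)).IsTree)
    {n n' : unitaryGroupOfForm σ ((StdForm.antidiagonal 3).over K)}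
    (hn : n ∈ unipotentU σ ((StdForm.antidiagonal 3).over K)) (hn' : n' ∈ unipotentU σ ((StdForm.antidiagonal 3).over K)) {i j : ℤ}
    (h : Sym2.map (latticeGraphIso σ ϖ ((StdForm.antidiagonal 3).over K) n) s(A i, A (i + 1)) =
      Sym2.map (latticeGraphIso σ ϖ ((StdForm.antidiagonal 3).over K) n') s(A j, A (j + 1))) : i = j := by
  refine eq_of_mem_unipotentU_of_sym2Map_apartmentEnum_eq_of_involution hσ hvσ hϖ A hA0 hA1 hT (n := n'⁻¹ * n) (mul_mem (inv_mem hn') hn) ?_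
  have h' := congrArg (Sym2.map (latticeGraphIso σ ϖ ((StdForm.antidiagonal 3).over K) n'⁻¹)) h
  rw [Sym2.map_map, Sym2.map_map, Sym2.map_mk, Sym2.map_mk] at h'
  simp only [Function.comp_apply, latticeGraphIso_inv_mul_apply] at h'
  rw [Sym2.map_mk, latticeGraphIso_mul_apply, latticeGraphIso_mul_apply]
  exact h'

/-- **(H7!e) `edgeSet` form of the uniqueness, any isometric involution** (certificates by ★ B1's `latticeGraph_adj_apartmentEnum_succ_of_involution`).  Conclusion VERBATIM = ★'s. [cite: BruhatTits1972, §10] [cite: Serre1980Trees, II.1.1] -/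
theorem eq_of_mem_unipotentU_of_mapEdgeSet_apartmentEnum_eq_of_involution (hσ : ∀ x, σ (σ x) = x) (hvσ : ∀ a, Valued.v (σ a) = Valued.v a) (hϖ : Valued.v ϖ = WithZero.exp (-1 : ℤ))
    (A : ℤ → {M : Submodule 𝒪[K] (Fin 3 → K) // IsVertex σ ϖ ((StdForm.antidiagonal 3).over K) M})
    (hA0 : ∀ a : ℤ, (A (2 * a)).1 = latt (Matrix.diagonal ![ϖ ^ a, (1 : K), ϖ ^ (-a)]))
    (hA1 : ∀ a : ℤ, (A (2 * a + 1)).1 = latt (Matrix.diagonal ![ϖ ^ (a + 1), (1 : K), ϖ ^ (-a)]))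
    (hT : (latticeGraph σ ϖ ((StdForm.antidiagonal 3).over K)).IsTree)
    {n n' : unitaryGroupOfForm σ ((StdForm.antidiagonal 3).over K)}
    (hn : n ∈ unipotentU σ ((StdForm.antidiagonal 3).over K)) (hn' : n' ∈ unipotentU σ ((StdForm.antidiagonal 3).over K)) {i j : ℤ}
    (h : (latticeGraphIso σ ϖ ((StdForm.antidiagonal 3).over K) n).mapEdgeSet
        ⟨s(A i, A (i + 1)), (mem_edgeSet _).2 (latticeGraph_adj_apartmentEnum_succ_of_involution hσ hvσ hϖ A hA0 hA1 i)⟩ =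
      (latticeGraphIso σ ϖ ((StdForm.antidiagonal 3).over K) n').mapEdgeSet
        ⟨s(A j, A (j + 1)), (mem_edgeSet _).2 (latticeGraph_adj_apartmentEnum_succ_of_involution hσ hvσ hϖ A hA0 hA1 j)⟩) : i = j :=
  eq_of_mem_unipotentU_of_sym2Map_apartmentEnum_eq₂_of_involution hσ hvσ hϖ A hA0 hA1 hT hn hn' (congrArg Subtype.val h)

/-! ## §4 (H8) BOREL ELEMENTS for any isometric involution: torus normal form (place-free), stabilisers, `B`-orbits = height fibres (place-free) -/

/-- **(H8₀) TORUS NORMAL FORM ON THE APARTMENT, FOR ANY ISOMETRIC INVOLUTION** — PLACE-FREE: every `t ∈ T` is `diag(d₀, d₁, d₂)` with `|d₀| = exp(−c)`, `|d₁| = 1`,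
`|d₂| = exp c`, and `t · A k = A (k + 2c)`.  Twin of ★ `exists_forall_latticeGraphIso_apartmentEnum_eq_add_of_mem_torusU`: `hd` was read for `|ϖ|`, `|σ·| = |·|` and the
torus translation (T) ∕ the unit-diagonal fixing (T′); here (T) is R1's any-involution `t_{−c} = diag(ϖ^{−c}, 1, (σϖ)^{c})` (the one forced token: the third entry of
`s = t_{−c} t` is `(σϖ)^c d₂`, a unit since `|σϖ| = |ϖ|`) and (T′) is R1's `…_of_unit_diagonal_of_v`.  Conclusion VERBATIM. [cite: BruhatTits1972, §10] [cite: Serre1980Trees, II.1.1; I.6.4] -/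
theorem exists_forall_latticeGraphIso_apartmentEnum_eq_add_of_mem_torusU_of_involution (hσ : ∀ x, σ (σ x) = x) (hvσ : ∀ a, Valued.v (σ a) = Valued.v a) (hϖ : Valued.v ϖ = WithZero.exp (-1 : ℤ))
    (A : ℤ → {M : Submodule 𝒪[K] (Fin 3 → K) // IsVertex σ ϖ ((StdForm.antidiagonal 3).over K) M})
    (hA0 : ∀ a : ℤ, (A (2 * a)).1 = latt (Matrix.diagonal ![ϖ ^ a, (1 : K), ϖ ^ (-a)]))
    (hA1 : ∀ a : ℤ, (A (2 * a + 1)).1 = latt (Matrix.diagonal ![ϖ ^ (a + 1), (1 : K), ϖ ^ (-a)]))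
    {t : unitaryGroupOfForm σ ((StdForm.antidiagonal 3).over K)}
    (ht : t ∈ torusU σ ((StdForm.antidiagonal 3).over K)) :
    ∃ c : ℤ, (∀ k : ℤ, latticeGraphIso σ ϖ ((StdForm.antidiagonal 3).over K) t (A k) = A (k + 2 * c)) ∧
      ∃ d : Fin 3 → Kˣ, glDiagonal 3 K d = (t : GL (Fin 3) K) ∧
        Valued.v (d 0 : K) = WithZero.exp (-c) ∧ Valued.v (d 1 : K) = 1 ∧ Valued.v (d 2 : K) = WithZero.exp c := by
  obtain ⟨d, hdrel, hdt⟩ := mem_torusOfForm_iff.1 ((mem_torusU_iff_mem_torusOfForm rfl t).1 ht)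
  have hvz : ∀ a : ℤ, Valued.v (ϖ ^ a) = WithZero.exp (-a) := fun a => by
    rw [map_zpow₀, hϖ, ← WithZero.exp_zsmul, smul_eq_mul, mul_neg, mul_one]
  -- valuations of the entries
  have h0ne : Valued.v (d 0 : K) ≠ 0 := (Valuation.ne_zero_iff _).2 (d 0).ne_zero
  set c : ℤ := -WithZero.log (Valued.v (d 0 : K)) with hc
  have hv0 : Valued.v (d 0 : K) = WithZero.exp (-c) := by
    rw [hc, neg_neg, WithZero.exp_log h0ne]
  have hv1 : Valued.v (d 1 : K) = 1 := by
    have h := congrArg Valued.v (hdrel 1)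
    rw [map_mul, map_one, hvσ, show Fin.rev (1 : Fin 3) = 1 from rfl] at h
    -- `x * x = 1` in `ℤᵐ⁰`: `x = exp a` with `a + a = 0`
    have h1ne : Valued.v (d 1 : K) ≠ 0 := (Valuation.ne_zero_iff _).2 (d 1).ne_zero
    rw [← WithZero.exp_log h1ne, ← WithZero.exp_add, WithZero.exp_eq_one] at h
    rw [← WithZero.exp_log h1ne, show WithZero.log (Valued.v (d 1 : K)) = 0 by omega, WithZero.exp_zero]
  have hv2 : Valued.v (d 2 : K) = WithZero.exp c := by
    have h := congrArg Valued.v (hdrel 0)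
    rw [map_mul, map_one, hvσ, show Fin.rev (0 : Fin 3) = 2 from rfl, hv0] at h
    -- `v(d 2) * exp(-c) = 1`
    have : Valued.v (d 2 : K) = (WithZero.exp (-c))⁻¹ := eq_inv_of_mul_eq_one_left h
    rw [this, WithZero.exp_neg, inv_inv]
  -- the translation `t_{-c}` and the unit-diagonal `s = t_{-c} * t`
  obtain ⟨t', ht'T, ht'mat, ht'A⟩ := exists_mem_torusU_latticeGraphIso_apartmentEnum_eq_add_of_involution hσ hvσ hϖ A hA0 hA1 (-c)
  have hsmat : (((t' * t : unitaryGroupOfForm σ ((StdForm.antidiagonal 3).over K)) : GL (Fin 3) K) : Matrix (Fin 3) (Fin 3) K) =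
      Matrix.diagonal ![ϖ ^ (-c) * (d 0 : K), 1 * (d 1 : K), (σ ϖ) ^ c * (d 2 : K)] := by
    rw [Subgroup.coe_mul, Units.val_mul, ht'mat, ← hdt, coe_glDiagonal, neg_neg]
    rw [show (Matrix.diagonal fun k => ((d k : Kˣ) : K)) = Matrix.diagonal ![(d 0 : K), (d 1 : K), (d 2 : K)] from by
      congr 1; funext k; fin_cases k <;> rfl]
    exact diagonal_three_mul _ _ _ _ _ _
  have hsu : Valued.v (ϖ ^ (-c) * (d 0 : K)) = 1 := by
    rw [map_mul, hvz, hv0, neg_neg, ← WithZero.exp_add, add_neg_cancel, WithZero.exp_zero]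
  have hss : Valued.v (1 * (d 1 : K)) = 1 := by rw [one_mul, hv1]
  have hvzσ : ∀ a : ℤ, Valued.v ((σ ϖ) ^ a) = WithZero.exp (-a) := fun a => by
    rw [map_zpow₀, hvσ, ← map_zpow₀]; exact hvz a
  have hsw : Valued.v ((σ ϖ) ^ c * (d 2 : K)) = 1 := by
    rw [map_mul, hvzσ, hv2, ← WithZero.exp_add, neg_add_cancel, WithZero.exp_zero]
  have hsfix := latticeGraphIso_apartmentEnum_eq_self_of_unit_diagonal_of_v hϖ A hA0 hA1 (t' * t) _ _ _ hsmat hsu hss hsw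
  refine ⟨c, fun k => ?_, d, hdt, hv0, hv1, hv2⟩
  -- `t · A k = t'⁻¹ · (s · A k) = t'⁻¹ · A k = A (k + 2c)` since `t' · A (k + 2c) = A k`
  have h1 : latticeGraphIso σ ϖ ((StdForm.antidiagonal 3).over K) t (A k) =
      latticeGraphIso σ ϖ ((StdForm.antidiagonal 3).over K) t'⁻¹ (latticeGraphIso σ ϖ ((StdForm.antidiagonal 3).over K) (t' * t) (A k)) := by
    rw [latticeGraphIso_mul_apply, latticeGraphIso_inv_mul_apply]
  have h2 : latticeGraphIso σ ϖ ((StdForm.antidiagonal 3).over K) t' (A (k + 2 * c)) = A k := by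
    rw [ht'A]; congr 1; ring
  rw [h1, hsfix k, ← h2, latticeGraphIso_inv_mul_apply]

/-- **(H8) BOREL STABILISERS, any isometric involution: `B ∩ Stab(A j) = C · (N ∩ Stab(A j))`** in ∃-currency (`b = t · n`, `t ∈ T` unit-diagonal ∈ `K₀` fixing every apartment
vertex, `n ∈ N` fixing `A j`), over the tree hypothesis `hT` ((H6)) and the place-free (H8₀); ★ `mem_unitaryInt_of_glDiagonal_eq_of_v_eq_one` by name.  Conclusion VERBATIM = ★'s.
[cite: BruhatTits1972, §10] [cite: Serre1980Trees, II.1.1; I.6.4] -/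
theorem exists_torusU_mul_unipotentU_of_mem_borelU_of_latticeGraphIso_apartmentEnum_eq_of_involution (hσ : ∀ x, σ (σ x) = x) (hvσ : ∀ a, Valued.v (σ a) = Valued.v a) (hϖ : Valued.v ϖ = WithZero.exp (-1 : ℤ))
    (A : ℤ → {M : Submodule 𝒪[K] (Fin 3 → K) // IsVertex σ ϖ ((StdForm.antidiagonal 3).over K) M})
    (hA0 : ∀ a : ℤ, (A (2 * a)).1 = latt (Matrix.diagonal ![ϖ ^ a, (1 : K), ϖ ^ (-a)]))
    (hA1 : ∀ a : ℤ, (A (2 * a + 1)).1 = latt (Matrix.diagonal ![ϖ ^ (a + 1), (1 : K), ϖ ^ (-a)]))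
    (hT : (latticeGraph σ ϖ ((StdForm.antidiagonal 3).over K)).IsTree)
    {b : unitaryGroupOfForm σ ((StdForm.antidiagonal 3).over K)}
    (hb : b ∈ borelU σ ((StdForm.antidiagonal 3).over K)) {j : ℤ} (h : latticeGraphIso σ ϖ ((StdForm.antidiagonal 3).over K) b (A j) = A j) :
    ∃ t n : unitaryGroupOfForm σ ((StdForm.antidiagonal 3).over K), t ∈ torusU σ ((StdForm.antidiagonal 3).over K) ∧
      t ∈ unitaryInt σ ((StdForm.antidiagonal 3).over K) ∧
      n ∈ unipotentU σ ((StdForm.antidiagonal 3).over K) ∧ b = t * n ∧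
      (∃ d : Fin 3 → Kˣ, glDiagonal 3 K d = (t : GL (Fin 3) K) ∧ ∀ i, Valued.v (d i : K) = 1) ∧
      (∀ k : ℤ, latticeGraphIso σ ϖ ((StdForm.antidiagonal 3).over K) t (A k) = A k) ∧
      latticeGraphIso σ ϖ ((StdForm.antidiagonal 3).over K) n (A j) = A j := by
  obtain ⟨⟨⟨t, htT⟩, ⟨n, hnN⟩⟩, htn, -⟩ :=
    (Subgroup.isComplement'_def.1 (isComplement'_torusU_unipotentU σ ((StdForm.antidiagonal 3).over K) rfl)).existsUnique ⟨b, hb⟩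
  have htT' : (t : unitaryGroupOfForm σ ((StdForm.antidiagonal 3).over K)) ∈ torusU σ ((StdForm.antidiagonal 3).over K) := Subgroup.mem_subgroupOf.1 htT
  have hnN' : (n : unitaryGroupOfForm σ ((StdForm.antidiagonal 3).over K)) ∈ unipotentU σ ((StdForm.antidiagonal 3).over K) := Subgroup.mem_subgroupOf.1 hnN
  have hbtn : b = (t : unitaryGroupOfForm σ ((StdForm.antidiagonal 3).over K)) * n := by
    have := congrArg Subtype.val htn
    exact this.symm
  obtain ⟨c, htA, d, hdt, hv0, hv1, hv2⟩ := exists_forall_latticeGraphIso_apartmentEnum_eq_add_of_mem_torusU_of_involution hσ hvσ hϖ A hA0 hA1 htT'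
  -- `n · A j = A (j - 2c)`
  have hnA : latticeGraphIso σ ϖ ((StdForm.antidiagonal 3).over K) n (A j) = A (j - 2 * c) := by
    have h1 : latticeGraphIso σ ϖ ((StdForm.antidiagonal 3).over K) (t : unitaryGroupOfForm σ ((StdForm.antidiagonal 3).over K))
        (latticeGraphIso σ ϖ ((StdForm.antidiagonal 3).over K) n (A j)) = A j := by
      rw [← latticeGraphIso_mul_apply, ← hbtn, h]
    have h2 : latticeGraphIso σ ϖ ((StdForm.antidiagonal 3).over K) (t : unitaryGroupOfForm σ ((StdForm.antidiagonal 3).over K)) (A (j - 2 * c)) = A j := by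
      rw [htA]; congr 1; ring
    exact (latticeGraphIso σ ϖ ((StdForm.antidiagonal 3).over K) (t : unitaryGroupOfForm σ ((StdForm.antidiagonal 3).over K))).injective (h1.trans h2.symm)
  have hc : c = 0 := by
    have := eq_of_mem_unipotentU_of_latticeGraphIso_apartmentEnum_eq_of_involution hσ hvσ hϖ A hA0 hA1 hT hnN' hnA
    omega
  subst hc
  have hv : ∀ i, Valued.v (d i : K) = 1 := by
    intro i
    fin_cases i
    · simpa using hv0
    · exact hv1
    · simpa using hv2
  refine ⟨t, n, htT', mem_unitaryInt_of_glDiagonal_eq_of_v_eq_one hdt hv, hnN', hbtn, ⟨d, hdt, hv⟩, fun k => ?_, ?_⟩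
  · rw [htA]; congr 1; ring
  · rw [hnA]; congr 1; ring

/-- **(H8′) `B`-ORBITS ARE HEIGHT FIBRES, FOR ANY ISOMETRIC INVOLUTION** — PLACE-FREE: for `b ∈ B`, `b · A j = n · A (j + 2c)` for some `n ∈ N`, `c ∈ ℤ` (`b = t n =
(t n t⁻¹) t`, ★ `borelU_le_normalizer`, (H8₀)).  Conclusion VERBATIM = ★'s. [cite: BruhatTits1972, §10] [cite: Serre1980Trees, II.1.1; I.6.4] -/
theorem exists_mem_unipotentU_latticeGraphIso_apartmentEnum_eq_of_mem_borelU_of_involution (hσ : ∀ x, σ (σ x) = x) (hvσ : ∀ a, Valued.v (σ a) = Valued.v a) (hϖ : Valued.v ϖ = WithZero.exp (-1 : ℤ))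
    (A : ℤ → {M : Submodule 𝒪[K] (Fin 3 → K) // IsVertex σ ϖ ((StdForm.antidiagonal 3).over K) M})
    (hA0 : ∀ a : ℤ, (A (2 * a)).1 = latt (Matrix.diagonal ![ϖ ^ a, (1 : K), ϖ ^ (-a)]))
    (hA1 : ∀ a : ℤ, (A (2 * a + 1)).1 = latt (Matrix.diagonal ![ϖ ^ (a + 1), (1 : K), ϖ ^ (-a)]))
    {b : unitaryGroupOfForm σ ((StdForm.antidiagonal 3).over K)}
    (hb : b ∈ borelU σ ((StdForm.antidiagonal 3).over K)) (j : ℤ) :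
    ∃ n : unitaryGroupOfForm σ ((StdForm.antidiagonal 3).over K), n ∈ unipotentU σ ((StdForm.antidiagonal 3).over K) ∧ ∃ c : ℤ,
      latticeGraphIso σ ϖ ((StdForm.antidiagonal 3).over K) b (A j) = latticeGraphIso σ ϖ ((StdForm.antidiagonal 3).over K) n (A (j + 2 * c)) := by
  obtain ⟨⟨⟨t, htT⟩, ⟨n, hnN⟩⟩, htn, -⟩ :=
    (Subgroup.isComplement'_def.1 (isComplement'_torusU_unipotentU σ ((StdForm.antidiagonal 3).over K) rfl)).existsUnique ⟨b, hb⟩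
  have htT' : (t : unitaryGroupOfForm σ ((StdForm.antidiagonal 3).over K)) ∈ torusU σ ((StdForm.antidiagonal 3).over K) := Subgroup.mem_subgroupOf.1 htT
  have hnN' : (n : unitaryGroupOfForm σ ((StdForm.antidiagonal 3).over K)) ∈ unipotentU σ ((StdForm.antidiagonal 3).over K) := Subgroup.mem_subgroupOf.1 hnN
  have hbtn : b = (t : unitaryGroupOfForm σ ((StdForm.antidiagonal 3).over K)) * n := by
    have := congrArg Subtype.val htn
    exact this.symm
  obtain ⟨c, htA, -⟩ := exists_forall_latticeGraphIso_apartmentEnum_eq_add_of_mem_torusU_of_involution hσ hvσ hϖ A hA0 hA1 htT'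
  -- `n' := t n t⁻¹ ∈ N`
  have hn' : (t : unitaryGroupOfForm σ ((StdForm.antidiagonal 3).over K)) * n * (t : unitaryGroupOfForm σ ((StdForm.antidiagonal 3).over K))⁻¹ ∈
      unipotentU σ ((StdForm.antidiagonal 3).over K) :=
    (Subgroup.mem_normalizer_iff.1 (borelU_le_normalizer σ ((StdForm.antidiagonal 3).over K) t.2) n).1 hnN'
  refine ⟨_, hn', c, ?_⟩
  rw [hbtn, latticeGraphIso_mul_apply, latticeGraphIso_mul_apply, latticeGraphIso_mul_apply, ← htA j, latticeGraphIso_inv_mul_apply]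

end Literature.NumberTheory.Automorphic.UnitaryLatticeTree
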